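import Summits.AnomalousDissipation.AnomalousDissipation.Theorems.TwoAndHalfDTwohalfdThesisStubShellNoGo
import Literature.Barriers.AnomalousDissipation.GravestModeLaminarAttractorSwept

/-!
# J1 `stub_releasedMixingWitness_false_of_subLogStrain`: the sibling crux's residual kills this line's kernel

Junction stub J1 of the line `Sketch` (duhamel-release) for the crux
`Summit.AnomalousDissipation.AnomalousDissipation.Theses.TwoAndHalfD.TwohalfdThesis`
(stmt-AnomalousDissipation-0206), lead c3.

The two crux chains of route `TwoAndHalfD` meet in ONE two-dimensional statement.  The negative crux
`TwohalfdNeg` (stmt-AnomalousDissipation-0211), line `log-kantorovich-enstrophy-transfer`, has the REGISTERED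
residual stub S6 `stub_subLogStrain` (its signature is the hypothesis below, verbatim): for every steady smooth solenoidal
mean-zero planar force `g`, every `ν_j → 0` and every global Leray–Hopf family `v_j` of 2-D Navier–Stokes
forced by `g` with `ν`-uniformly bounded limsup-mean energy, the limsup-mean strain is sub-logarithmic,
`⟨‖∇v_j‖₂⟩ / log(1/ν_j) → 0`.  THIS FILE certifies by name that S6 REFUTES the kernel W
(`stub_releasedMixingWitness`) of the present line: `S6 → ¬ W-body`
(`stub_releasedMixingWitness_false_of_subLogStrain`).  So the fate of line `Sketch` is EXACTLY the 2-D law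
S6: if S6 is proved the line is dead (and `TwohalfdNeg` follows by the sibling certificate); a W-witness
must be a bounded-energy steadily forced planar family with `limsup_j ⟨‖∇v_j‖₂⟩/log(1/ν_j) > 0`.

PROOF.  A W-body gives `h ≠ 0` (Green–Kubo floor `ε > 0`), a lossy lag `τ₀` (`Λ(τ₀) ≤ 1/2`, integrable
envelope; loss `δ = 3/4` from every late release), hence by the landed strain-gate bridge
`releasedFamily_not_subLogStrain` (p111103) `¬(⟨‖∇v_j‖₂⟩/log(1/ν_j) → 0)`; while the classical family is
global Leray–Hopf from its own slices (`isGlobalLerayHopf_of_isClassicalNSSolutionOn_Ici`) with mean energy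
`≤ E` (pointwise energy ceiling, `meanEnergy_le_of_forall_le`), so S6 applies to it — contradiction.
Supports stmt-AnomalousDissipation-0206. [folklore]
-/

noncomputable section

-- the summit path `AnomalousDissipation/AnomalousDissipation` duplicates a namespace component
set_option linter.dupNamespace false

namespace Summit.AnomalousDissipation.AnomalousDissipation.Theorems.TwohalfdThesis

open MeasureTheory Set Filter Topology
open scoped ENNReal NNReal InnerProductSpace
open Literature.Analysis.FunctionSpaces Literature.Analysis.FluidPDE

/-- **J1 `stub_releasedMixingWitness_false_of_subLogStrain` (line `Sketch` = duhamel-release, crux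
`TwoAndHalfD.TwohalfdThesis`; registered signature): the sibling crux's residual S6 kills the kernel W.**
`(signature of 0211's stub_subLogStrain) → ¬ (body of stub_releasedMixingWitness)`; S6 is OPEN and is
taken as a hypothesis, never asserted (no `def … : Prop` is minted for it here).  Proof: Green–Kubo floor ⇒ `h ≠ 0`; integrable
envelope ⇒ a lossy lag `τ₀` with loss `3/4` from every late release; strain-gate bridge
`releasedFamily_not_subLogStrain` ⇒ the mean strain is NOT `o(log(1/ν_j))`; but the classical family is
global Leray–Hopf with mean energy `≤ E`, so S6 says it is. [folklore] -/
theorem stub_releasedMixingWitness_false_of_subLogStrain :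
    (∀ g : UnitAddTorus (Fin 2) → EuclideanSpace ℝ (Fin 2), Torus.IsSmooth g → Torus.IsDivFree g →
      Torus.HasZeroMean g →
      ∀ (ν : ℕ → ℝ) (v₀ : ℕ → UnitAddTorus (Fin 2) → EuclideanSpace ℝ (Fin 2))
        (v : ℕ → ℝ → UnitAddTorus (Fin 2) → EuclideanSpace ℝ (Fin 2)),
        (∀ j, 0 < ν j) → Tendsto ν atTop (𝓝 0) →
        (∀ j, Torus.IsGlobalLerayHopf (ν j) (fun _ => g) (v₀ j) (v j)) →
        (∃ E : ℝ, ∀ j, meanEnergy (v j) ≤ E) →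
        Tendsto (fun j => longTimeAvgSup (fun t => Real.sqrt (Torus.eGradNormSq (v j t)).toReal) /
          Real.log (ν j)⁻¹) atTop (𝓝 0)) →
    ¬ (∃ (g : (UnitAddTorus (Fin 2)) → (EuclideanSpace ℝ (Fin 2))) (h : (UnitAddTorus (Fin 2)) → ℝ),
        Torus.IsSmooth g ∧ Torus.IsDivFree g ∧ Torus.HasZeroMean g ∧ Torus.IsSmooth h ∧ Torus.HasZeroMean h ∧
        ∃ (ν : ℕ → ℝ) (v : ℕ → ℝ → (UnitAddTorus (Fin 2)) → (EuclideanSpace ℝ (Fin 2)))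
          (p : ℕ → ℝ → (UnitAddTorus (Fin 2)) → ℝ) (φ : ℕ → ℝ → ℝ → (UnitAddTorus (Fin 2)) → ℝ)
          (Λ : ℝ → ℝ) (E s₀ M ε : ℝ),
          (∀ j, 0 < ν j) ∧ Tendsto ν atTop (𝓝 0) ∧
          (∀ j, Torus.IsClassicalNSSolutionOn (Ici 0) (ν j) (fun _ => g) (v j) (p j)) ∧
          (∀ j t, 0 ≤ t → ∫ x, ‖v j t x‖ ^ 2 ≤ E) ∧
          (∀ j s, 0 ≤ s → Torus.IsClassicalScalarTransportOn (Ici s) (ν j) (v j) (φ j s) ∧ φ j s s = h) ∧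
          0 ≤ s₀ ∧ (∀ τ, 0 ≤ Λ τ) ∧ IntegrableOn Λ (Ici 0) ∧ (∫ τ in Ici 0, Λ τ) ≤ M ∧
          (∀ j s t, s₀ ≤ s → s ≤ t → Torus.scalarL2Sq (φ j s t) ≤ Λ (t - s) ^ 2 * Torus.scalarL2Sq h) ∧
          0 < ε ∧
          (∀ j, ε ≤ liminf (timeMean fun t => ∫ s in (0 : ℝ)..t, ∫ x, h x * φ j s t x) atTop)) := by
  intro hS6
  rintro ⟨g, h, hgs, hgd, hgz, hhs, _hhz, ν, v, p, φ, Λ, E, s₀, M, ε, hν, hν0, hNS, hE, hrel, hs₀, hΛ0,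
    hΛi, _hΛM, henv, hε, hGK⟩
  -- `h ≠ 0` by the Green–Kubo floor
  have hh0 : 0 < Torus.scalarL2Sq h := by
    by_contra hcon
    have hzero : h = 0 := by
      by_contra hne
      exact hcon (scalarL2Sq_pos_of_ne_zero hhs hne)
    have h1 := hGK 0
    have hconst : (timeMean fun t => ∫ s in (0 : ℝ)..t, ∫ x, h x * φ 0 s t x) = fun _ => 0 := by
      funext T
      simp [timeMean, hzero]
    rw [hconst, liminf_const] at h1
    exact absurd h1 (not_le.2 hε)
  -- a lossy lag: loss `3/4` by age `τ₀` from every late release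
  obtain ⟨τ₀, hτ₀, hΛτ⟩ := exists_pos_lag_le_half hΛi
  have hloss : ∀ j s, s₀ ≤ s →
      Torus.scalarL2Sq (φ j s (s + τ₀)) ≤ (1 - 3 / 4) * Torus.scalarL2Sq h := by
    intro j s hs
    have h1 := henv j s (s + τ₀) hs (by linarith)
    rw [add_sub_cancel_left] at h1
    have hΛsq : Λ τ₀ ^ 2 ≤ 1 / 4 := by nlinarith [hΛ0 τ₀]
    calc Torus.scalarL2Sq (φ j s (s + τ₀)) ≤ Λ τ₀ ^ 2 * Torus.scalarL2Sq h := h1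
      _ ≤ (1 / 4) * Torus.scalarL2Sq h := mul_le_mul_of_nonneg_right hΛsq hh0.le
      _ = (1 - 3 / 4) * Torus.scalarL2Sq h := by norm_num
  -- the strain-gate bridge: the family is NOT sub-log-strain
  have hnot := releasedFamily_not_subLogStrain hν hν0 hgs hgz hNS hhs hh0 hτ₀ (by norm_num : (0 : ℝ) < 3 / 4)
    hrel hs₀ hloss
  -- but it is a bounded-energy global Leray–Hopf family, so S6 says it is
  refine hnot (hS6 g hgs hgd hgz ν (fun j => v j 0) v hν hν0
    (fun j => isGlobalLerayHopf_of_isClassicalNSSolutionOn_Ici (hNS j)) ⟨E, fun j => ?_⟩)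
  exact Literature.Barriers.AnomalousDissipation.meanEnergy_le_of_forall_le fun t ht => hE j t ht.le

end Summit.AnomalousDissipation.AnomalousDissipation.Theorems.TwohalfdThesis

end
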